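import Mathlib
import Summits.ValiantsHypothesis.ValiantsHypothesis.Theorems.LiouvilleSarnakLiouvilleCutRankScatteredBlocksFiller
import Summits.ValiantsHypothesis.ValiantsHypothesis.Theorems.LiouvilleSarnakLiouvilleCutRankInterleavedUnbounded
import HarnessLib

/-!
# Route LiouvilleSarnak — crux `LiouvilleCutRank` (stmt-ValiantsHypothesis-14775):
# scattered blocks — the SELECTION form (any sub-collection of the blocks, renormalised, with a free filler)

Third file of the scattered-block reduction of the OPEN crux `LiouvilleCutRank` (`…ScatteredBlocks` p831263: crux ⟸
«every normalised gap sequence gives rank `≥ W`»; `…ScatteredBlocksFiller` p831341: a free filler `H` off the blocks).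
Here the hypothesis is widened once more, to its natural Ramsey-type form: from the `t + 1` factors `CR` a prover may
SELECT any sub-collection `e 0 < ⋯ < e m`, renormalise at the first selected block (everything below it becomes the prefix
of ones), and fill every other position (including the unselected blocks) with digits of his choice.  And the hypothesis
schema is shown to be non-vacuous: on the arithmetic gap sequence `g i = 2i` it holds by name (`…InterleavedUnbounded`).

* §1 `exists_blocks_of_changes_ge` — a cut word with `≥ 2t + 1` letter changes has `t + 1` factors `CR` at increasing
  positions pairwise `≥ 2` apart, for the cut itself or for the swapped cut (reusable extraction step).
* §2 ★★ `liouvilleCutRank_of_scatteredBlocks_select` — `LiouvilleCutRank ⟸ ∀ W ∃ t ∀ g` (normalised, gaps `≥ 2`)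
  `∃` selection `e`, `∃` admissible filler `H`: `rank (λ(1 + H + Σ_{i ≤ m} (2 x_i + y_i) 2^{g (e i) - g (e 0)}))_{x,y} ≥ W`.
* §3 `scatteredBlocks_interleaved` — `∀ W ∃ t₀ ∀ t ≥ t₀`: `rank (λ(1 + Σ_{i<t} (2 x_i + y_i) 4^i))_{x,y} ≥ W`
  (the matrix IS the bit-interleaving cut matrix at level `t`, `…InterleavedKernel.cutNumber_interleaved`).

Honest framing: bookkeeping around the reduction (widest word-free sufficient condition this method gives) plus the one
gap sequence on which it is known; the hypothesis for arbitrary gaps is open; `LiouvilleCutRank`, `DigitalBilinearLiouville`,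
`AlgebraicSarnak` stay OPEN; nothing bears on `VP ≠ VNP`.  No definitions.
-/

set_option linter.dupNamespace false

noncomputable section

namespace Summit.ValiantsHypothesis.ValiantsHypothesis.Theorems.LiouvilleSarnakLiouvilleCutRank.ScatteredBlocksSelect

open ArithmeticFunction Finset

open Summit.ValiantsHypothesis.ValiantsHypothesis.Theorems.LiouvilleSarnakLiouvilleCutRank.ScatteredBlocks
  (liouvilleCutRank_iff_manyChanges)
open Summit.ValiantsHypothesis.ValiantsHypothesis.Theorems.LiouvilleSarnakLiouvilleCutRank.ScatteredBlocksFiller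
  (rank_blocks_filler_le_rank)
open Summit.ValiantsHypothesis.ValiantsHypothesis.Theorems.LiouvilleSarnakLiouvilleCutRank.CutTranspose
  (rank_cutMatrix_swap)
open Summit.ValiantsHypothesis.ValiantsHypothesis.Theses.LiouvilleSarnak (LiouvilleCutRank)
open Summit.ValiantsHypothesis.ValiantsHypothesis.Theorems.LiouvilleSarnakLiouvilleCutRank.Interleaved
  (cutNumber_interleaved exists_interleavedCut)
open Summit.ValiantsHypothesis.ValiantsHypothesis.Theorems.LiouvilleSarnakLiouvilleCutRank.InterleavedUnbounded
  (interleavedCutRank)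

/-! ### §1 Extracting the blocks from a word with many letter changes -/

/-- In the word of a cut with at least `2t + 1` letter changes there are `t + 1` factors `CR` at increasing positions
(pairwise `≥ 2` apart), either for the cut itself or for the swapped cut `π ∘ swap` (whose word is the complement).
[this file] -/
theorem exists_blocks_of_changes_ge (t n : ℕ) (π : Fin n ⊕ Fin n ≃ Fin (2 * n)) (w : ℕ → Bool)
    (hw : ∀ j : Fin (2 * n), w j = (π.symm j).isLeft)
    (hch : 2 * t + 1 ≤ ((range (2 * n - 1)).filter fun j => w j ≠ w (j + 1)).card) :
    ∃ (π' : Fin n ⊕ Fin n ≃ Fin (2 * n)) (w' : ℕ → Bool) (k : Fin (t + 1) → ℕ),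
      (π' = π ∨ π' = (Equiv.sumComm (Fin n) (Fin n)).trans π) ∧
      (∀ j : Fin (2 * n), w' j = (π'.symm j).isLeft) ∧ StrictMono k ∧
      (∀ i, k i + 1 < 2 * n ∧ w' (k i) = false ∧ w' (k i + 1) = true) ∧
      (∀ i j : Fin (t + 1), i < j → k i + 2 ≤ k j) := by
  classical
  -- from `t + 1` factors `CR` of a word to the block positions
  have hstep : ∀ (π' : Fin n ⊕ Fin n ≃ Fin (2 * n)) (w' : ℕ → Bool),
      (∀ j : Fin (2 * n), w' j = (π'.symm j).isLeft) →
      t + 1 ≤ ((range (2 * n - 1)).filter fun j => w' j = false ∧ w' (j + 1) = true).card →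
      ∃ k : Fin (t + 1) → ℕ, StrictMono k ∧ (∀ i, k i + 1 < 2 * n ∧ w' (k i) = false ∧ w' (k i + 1) = true) ∧
        (∀ i j : Fin (t + 1), i < j → k i + 2 ≤ k j) := by
    intro π' w' hw' hcard
    obtain ⟨S, hSsub, hScard⟩ := Finset.exists_subset_card_eq hcard
    let k : Fin (t + 1) → ℕ := fun i => S.orderEmbOfFin hScard i
    have hkS : ∀ i, k i ∈ S := fun i => Finset.orderEmbOfFin_mem S hScard i
    have hkmono : StrictMono k := (S.orderEmbOfFin hScard).strictMono
    have hkprop : ∀ i, k i < 2 * n - 1 ∧ w' (k i) = false ∧ w' (k i + 1) = true := by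
      intro i
      have hmem := hSsub (hkS i)
      simpa [mem_filter, mem_range] using hmem
    refine ⟨k, hkmono, fun i => ⟨by have := (hkprop i).1; omega, (hkprop i).2.1, (hkprop i).2.2⟩, ?_⟩
    intro i j hij
    have hlt : k i < k j := hkmono hij
    by_contra hcon
    have heq : k j = k i + 1 := by omega
    have h1 := (hkprop i).2.2
    have h2 := (hkprop j).2.1
    rw [heq, h1] at h2
    exact Bool.noConfusion h2
  have hsub : ((range (2 * n - 1)).filter fun j => w j ≠ w (j + 1)) ⊆
      ((range (2 * n - 1)).filter fun j => w j = false ∧ w (j + 1) = true) ∪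
      ((range (2 * n - 1)).filter fun j => w j = true ∧ w (j + 1) = false) := by
    intro j hj
    rw [mem_filter] at hj
    rw [mem_union, mem_filter, mem_filter]
    rcases hj with ⟨hjr, hne⟩
    cases h0 : w j <;> cases h1 : w (j + 1) <;> simp_all
  have hcard := hch.trans ((card_le_card hsub).trans (card_union_le _ _))
  by_cases hCR : t + 1 ≤ ((range (2 * n - 1)).filter fun j => w j = false ∧ w (j + 1) = true).card
  · obtain ⟨k, hk1, hk2, hk3⟩ := hstep π w hw hCR
    exact ⟨π, w, k, Or.inl rfl, hw, hk1, hk2, hk3⟩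
  · have hRC : t + 1 ≤ ((range (2 * n - 1)).filter fun j => w j = true ∧ w (j + 1) = false).card := by
      omega
    have hw' : ∀ j : Fin (2 * n), (!w j) = (((Equiv.sumComm (Fin n) (Fin n)).trans π).symm j).isLeft := by
      intro j
      rw [hw j]
      show (!(π.symm j).isLeft) = (Sum.swap (π.symm j)).isLeft
      cases π.symm j <;> rfl
    have hfilter : ((range (2 * n - 1)).filter fun j => (!w j) = false ∧ (!w (j + 1)) = true) =
        ((range (2 * n - 1)).filter fun j => w j = true ∧ w (j + 1) = false) := by
      refine Finset.filter_congr (fun j _ => ?_)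
      cases w j <;> cases w (j + 1) <;> simp
    obtain ⟨k, hk1, hk2, hk3⟩ := hstep ((Equiv.sumComm (Fin n) (Fin n)).trans π) (fun j => !w j) hw'
      (by rw [hfilter]; exact hRC)
    exact ⟨(Equiv.sumComm (Fin n) (Fin n)).trans π, fun j => !w j, k, Or.inr rfl, hw', hk1, hk2, hk3⟩

/-! ### §2 The selection form of the scattered-block hypothesis -/

/-- ★★ **`LiouvilleCutRank` from a SELECTION of scattered blocks.**  Suppose that for every `W` there is `t` such that
for every normalised gap sequence `0 = g 0 < ⋯ < g t` (gaps `≥ 2`) one can SELECT blocks `e 0 < e 1 < ⋯ < e m` and a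
filler `H < 2^{g (e m) - g (e 0) + 2}` with binary digits vanishing at the selected (renormalised) block positions
`g (e i) - g (e 0)`, `g (e i) - g (e 0) + 1`, such that
`rank (λ(1 + H + Σ_{i ≤ m} (2 x_i + y_i) 2^{g (e i) - g (e 0)}))_{x, y ∈ {0,1}^{m+1}} ≥ W`.  Then `LiouvilleCutRank`.
(The unselected blocks and the stretch below `g (e 0)` are absorbed into the prefix of ones and the filler:
`ScatteredBlocksFiller.rank_blocks_filler_le_rank` at `p = k (e 0)`; the all-blocks case `e = id` is
`…ScatteredBlocksFiller.liouvilleCutRank_of_scatteredBlocks_filler`.) [this file] -/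
theorem liouvilleCutRank_of_scatteredBlocks_select
    (h : ∀ W : ℕ, ∃ t : ℕ, ∀ g : Fin (t + 1) → ℕ, g 0 = 0 → (∀ i j : Fin (t + 1), i < j → g i + 2 ≤ g j) →
      ∃ (m : ℕ) (e : Fin (m + 1) → Fin (t + 1)), StrictMono e ∧ ∃ H : ℕ,
        H < 2 ^ (g (e (Fin.last m)) - g (e 0) + 2) ∧
        (∀ i, H.testBit (g (e i) - g (e 0)) = false ∧ H.testBit (g (e i) - g (e 0) + 1) = false) ∧
        W ≤ (Matrix.of fun x y : Fin (m + 1) → Bool =>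
          (((liouville ((∑ i : Fin (m + 1), (2 * (x i).toNat + (y i).toNat) * 2 ^ (g (e i) - g (e 0))) + H + 1) :
            ℤ) : ℂ))).rank) :
    LiouvilleCutRank := by
  classical
  rw [liouvilleCutRank_iff_manyChanges]
  intro W
  obtain ⟨t, ht⟩ := h W
  refine ⟨2 * t + 1, 0, fun n _ π w hw hch => ?_⟩
  obtain ⟨π', w', k, hπ', hw', hkmono, hkprop, hgap⟩ := exists_blocks_of_changes_ge t n π w hw hch
  -- the rank of the (possibly swapped) cut matrix is that of `M_π`
  have hrank : (Matrix.of fun r c : Fin n → Bool =>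
      (((liouville (Nat.ofBits (fun j : Fin (2 * n) => Sum.elim r c (π'.symm j)) + 1) : ℤ) : ℂ))).rank =
      (Matrix.of fun r c : Fin n → Bool =>
      (((liouville (Nat.ofBits (fun j : Fin (2 * n) => Sum.elim r c (π.symm j)) + 1) : ℤ) : ℂ))).rank := by
    rcases hπ' with rfl | rfl
    · rfl
    · exact rank_cutMatrix_swap n π
  rw [← hrank]
  have hk0 : ∀ i, k 0 ≤ k i := fun i => hkmono.monotone (Fin.zero_le i)
  obtain ⟨m, e, he, H, hH, hHb, hW⟩ := ht (fun i => k i - k 0) (by simp)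
    (by intro i j hij; have := hgap i j hij; have := hk0 i; omega)
  -- the selected blocks
  have he0 : ∀ i, k (e 0) ≤ k (e i) := fun i => hkmono.monotone (he.monotone (Fin.zero_le i))
  have hsubst : ∀ i, (k (e i) - k 0) - (k (e 0) - k 0) = k (e i) - k (e 0) := by
    intro i; have := hk0 (e 0); have := he0 i; omega
  have hH' : H < 2 ^ (2 * n - k (e 0)) := by
    refine lt_of_lt_of_le hH (Nat.pow_le_pow_right (by norm_num) ?_)
    have := (hkprop (e (Fin.last m))).1
    have := he0 (Fin.last m)
    show (k (e (Fin.last m)) - k 0) - (k (e 0) - k 0) + 2 ≤ 2 * n - k (e 0)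
    omega
  have hle := rank_blocks_filler_le_rank n (m + 1) (k (e 0)) π' w' hw'
    (by have := (hkprop (e 0)).1; omega) (fun i => k (e i)) he0
    (fun i => (hkprop (e i)).1) (fun i => (hkprop (e i)).2.1) (fun i => (hkprop (e i)).2.2)
    (fun i j hij => hgap (e i) (e j) (he hij)) H hH'
    (fun i => by
      have h1 := (hHb i).1
      have h2 := (hHb i).2
      simp only [hsubst i] at h1 h2
      exact ⟨h1, h2⟩)
  have hmat : (Matrix.of fun x y : Fin (m + 1) → Bool =>
      (((liouville ((∑ i : Fin (m + 1), (2 * (x i).toNat + (y i).toNat) *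
        2 ^ ((fun i => k i - k 0) (e i) - (fun i => k i - k 0) (e 0))) + H + 1) : ℤ) : ℂ))) =
      (Matrix.of fun x y : Fin (m + 1) → Bool =>
      (((liouville ((∑ i : Fin (m + 1), (2 * (x i).toNat + (y i).toNat) * 2 ^ (k (e i) - k (e 0))) + H + 1) :
        ℤ) : ℂ))) := by
    ext x y
    simp only [Matrix.of_apply]
    rw [Finset.sum_congr rfl (fun i _ => by rw [hsubst i])]
  rw [hmat] at hW
  exact hW.trans hle

/-! ### §3 The hypothesis on the interleaved subfamily -/

/-- **The scattered-block matrices of the ARITHMETIC gap sequence `g i = 2i` have unbounded rank** — the instance of the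
scattered-block hypothesis on the interleaved prototype, by name from `…InterleavedUnbounded.interleavedCutRank`: the
matrix `(λ(1 + Σ_{i<t} (2 x_i + y_i) 4^i))_{x,y}` IS the cut matrix of the bit-interleaving cut at level `t`
(`…InterleavedKernel.cutNumber_interleaved`).  So the hypothesis schema of `…ScatteredBlocks` is non-vacuous; arbitrary
gap sequences are what remains. [this file] -/
theorem scatteredBlocks_interleaved (W : ℕ) : ∃ t₀ : ℕ, ∀ t : ℕ, t₀ ≤ t →
    W ≤ (Matrix.of fun x y : Fin t → Bool =>
      (((liouville ((∑ i : Fin t, (2 * (x i).toNat + (y i).toNat) * 2 ^ (2 * (i : ℕ))) + 1) : ℤ) : ℂ))).rank := by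
  obtain ⟨n₀, hn₀⟩ := interleavedCutRank W
  refine ⟨n₀, fun t ht => ?_⟩
  obtain ⟨π, hπ⟩ := exists_interleavedCut t
  have h := hn₀ t ht π hπ
  have hmat : (Matrix.of fun r c : Fin t → Bool =>
      (((liouville (Nat.ofBits (fun k : Fin (2 * t) => Sum.elim r c (π.symm k)) + 1) : ℤ) : ℂ))) =
      (Matrix.of fun x y : Fin t → Bool =>
      (((liouville ((∑ i : Fin t, (2 * (x i).toNat + (y i).toNat) * 2 ^ (2 * (i : ℕ))) + 1) : ℤ) : ℂ))) := by
    ext r c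
    simp only [Matrix.of_apply]
    have hsum : 2 * (∑ i : Fin t, (r i).toNat * 4 ^ (i : ℕ)) + ∑ i : Fin t, (c i).toNat * 4 ^ (i : ℕ) =
        ∑ i : Fin t, (2 * (r i).toNat + (c i).toNat) * 2 ^ (2 * (i : ℕ)) := by
      rw [Finset.mul_sum, ← Finset.sum_add_distrib]
      refine Finset.sum_congr rfl (fun i _ => ?_)
      rw [pow_mul]
      norm_num
      ring
    rw [cutNumber_interleaved t π hπ r c, hsum]
  rwa [hmat] at h

end Summit.ValiantsHypothesis.ValiantsHypothesis.Theorems.LiouvilleSarnakLiouvilleCutRank.ScatteredBlocksSelect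

end
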